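import Literature.AlgebraicGeometry.Resolution.AlterationsDescent
import Literature.AlgebraicGeometry.Limits.ClosedSubschemes
import Literature.AlgebraicGeometry.Limits.IdealSheafComap
import Literature.AlgebraicGeometry.Limits.FieldExtensionDiagram
import HarnessLib

/-!
# De Jong 1996, 4.5: the limit argument, I — set-up and the first stage

Topic: `Literature/AlgebraicGeometry/Resolution`. Towards the discharge of the named fact
`DeJong1996.FiniteSubextension45` (de Jong 1996, 4.5: "There exists a finite extension `k₁` of `k`
contained in `k̄` such that `X̄', X̄₁, X̄̄₁, φ̄₁` and `j̄₁` exist over `k₁`"). This file fixes the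
data of 4.5 over `K = k̄` (`DeJong1996.Descent45.Setup`: a variety `X/k`, a closed `Z`, an
irreducible component `X̄'` of `X_K = Spec K ×_k X` and a solution of Thm. 4.1 for `(X̄', Z̄')`
with a projective embedding `X̄̄₁ ↪ ℙⁿ_K`), presents `X_K` and `ℙⁿ_k ×_k Spec K ≅ ℙⁿ_K` as
limits of the base changes `X_t`, `P_t` to the finite subextensions `k(t)`
(`Literature.AlgebraicGeometry.Limits.FieldExt`), and performs the first descent step: by
`Literature.AlgebraicGeometry.Limits.exists_isPullback_toImage_of_isLocallyNoetherian`
(Görtz–Wedhorn I, Prop. 10.75 (1)) there is a stage `s₀` from which on the closed subschemes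
`X̄' ↪ X_K` and `X̄̄₁ ↪ ℙⁿ_K` are the base changes of their scheme-theoretic images
`X'₀ ↪ X_{s₀}`, `X̄̄₀ ↪ P_{s₀}` (`Setup.exists_stage₀`).

## References

* A. J. de Jong, *Smoothness, semi-stability and alterations*, Publ. Math. IHÉS 83 (1996), 4.5.
* U. Görtz, T. Wedhorn, *Algebraic Geometry I* (2020), (10.13), Prop. 10.75.
-/

noncomputable section

universe u

open CategoryTheory CategoryTheory.Limits AlgebraicGeometry TopologicalSpace
  Literature.AlgebraicGeometry.Limits Literature.AlgebraicGeometry.Limits.FieldExt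
  Literature.AlgebraicGeometry.Motives

namespace Literature.AlgebraicGeometry.Resolution

namespace DeJong1996.Descent45

set_option backward.isDefEq.respectTransparency false

variable (k K : Type u) [Field k] [Field K] [Algebra k K]

/-! ## The level-one diagrams: base change of a `k`-scheme to the `k(t)` -/

/-- The structure map `k → K` in `CommRingCat`. [folklore] -/
abbrev σ₁ : CommRingCat.of k ⟶ CommRingCat.of K := CommRingCat.ofHom (algebraMap k K)

/-- The diagram `t ↦ Spec k(t) ×_k Y` of base changes of a `k`-scheme `Y` to the finite
subextensions `k(t)`, `t ⊇ s` (`Literature.AlgebraicGeometry.Limits.FieldExt.schemeDiagram`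
for the base `k`). [folklore] -/
abbrev D₁ (s : Finset K) (Y : Over (Spec (CommRingCat.of k))) : (Idx K s)ᵒᵖ ⥤ Scheme.{u} :=
  schemeDiagram k K s (.of k) (baseNat k K s) Y

/-- The cone `Spec K ×_k Y → Spec k(t) ×_k Y`. [folklore] -/
abbrev c₁ (s : Finset K) (Y : Over (Spec (CommRingCat.of k))) : Cone (D₁ k K s Y) :=
  schemeCone k K s (.of k) (baseNat k K s) (σ₁ k K) (baseNat_ι k K s) Y

/-- `Spec K ×_k Y = lim_t Spec k(t) ×_k Y`. [folklore] -/
abbrev isLimit_c₁ (s : Finset K) (Y : Over (Spec (CommRingCat.of k))) : IsLimit (c₁ k K s Y) :=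
  isLimitSchemeCone k K s (.of k) (baseNat k K s) (σ₁ k K) (baseNat_ι k K s) Y

/-! ## The data of 4.5 over `K` -/

/-- **The data of de Jong 1996, 4.5 over `k̄ = K`**, in the form in which the limit argument
consumes it: a variety `f : X → Spec k`, a closed `Z ⊆ X`, an integral closed subscheme
`ιb : X̄' ↪ X_K = Spec K ×_k X` whose image is an irreducible component, and a solution of
Thm. 4.1 (with its generically-étale clause) for `(X̄' → Spec K, Z̄')`: an alteration
`φ₁ : X₁ → X̄'`, an open immersion `j₁ : X₁ → X̄̄₁` into an integral regular `K`-scheme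
`g : X̄̄₁ → Spec K` with a closed `K`-immersion `cbar : X̄̄₁ ↪ ℙⁿ_K`, the compatibility
`j₁ ≫ g = φ₁ ≫ ιb ≫ pr_{Spec K}`, the strict normal crossings boundary, and a dense open `W₁ ⊆ X₁`
on which `φ₁` is étale. [cite: DeJong1996, 4.5, p. 66] -/
structure Setup where
  /-- the variety -/
  X : Scheme.{u}
  /-- its structure morphism -/
  f : X ⟶ Spec (CommRingCat.of k)
  [isIntegral_X : IsIntegral X]
  [isSeparated_f : IsSeparated f]
  [locallyOfFiniteType_f : LocallyOfFiniteType f]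
  [quasiCompact_f : QuasiCompact f]
  /-- the closed subset -/
  Z : Set X
  isClosed_Z : IsClosed Z
  /-- the component `X̄'` of `X_K` -/
  Xb : Scheme.{u}
  /-- its closed immersion into `X_K = Spec K ×_k X` -/
  ιb : Xb ⟶ pullback (Spec.map (σ₁ k K)) f
  [isIntegral_Xb : IsIntegral Xb]
  [isClosedImmersion_ιb : IsClosedImmersion ιb]
  range_ιb_mem : Set.range ιb ∈ irreducibleComponents (↑(pullback (Spec.map (σ₁ k K)) f) : Type u)
  /-- the source of the alteration -/
  X₁ : Scheme.{u}
  /-- the compactification -/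
  Xbar₁ : Scheme.{u}
  /-- the alteration -/
  φ₁ : X₁ ⟶ Xb
  /-- the open immersion -/
  j₁ : X₁ ⟶ Xbar₁
  /-- the structure morphism of the compactification -/
  g : Xbar₁ ⟶ Spec (CommRingCat.of K)
  isAlteration_φ₁ : IsAlteration φ₁
  [isOpenImmersion_j₁ : IsOpenImmersion j₁]
  [isIntegral_Xbar₁ : IsIntegral Xbar₁]
  /-- the dimension of the ambient projective space -/
  n : ℕ
  /-- the projective embedding over `K` -/
  cbar : Over.mk g ⟶ projectiveSpace n K
  [isClosedImmersion_cbar : IsClosedImmersion cbar.left]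
  isRegular_Xbar₁ : Scheme.IsRegular Xbar₁
  w : j₁ ≫ g = φ₁ ≫ ιb ≫ pullback.fst (Spec.map (σ₁ k K)) f
  isSNC : IsStrictNormalCrossingsDivisor Xbar₁
    (j₁ '' (φ₁ ⁻¹' ((ιb ≫ pullback.snd (Spec.map (σ₁ k K)) f) ⁻¹' Z)) ∪ (Set.range j₁)ᶜ)
  /-- the étale locus -/
  W₁ : X₁.Opens
  dense_W₁ : Dense (W₁ : Set X₁)
  etale_W₁ : Etale (W₁.ι ≫ φ₁)

namespace Setup

attribute [instance] isIntegral_X isSeparated_f locallyOfFiniteType_f quasiCompact_f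
  isIntegral_Xb isClosedImmersion_ιb isOpenImmersion_j₁ isIntegral_Xbar₁ isClosedImmersion_cbar

variable {k K} (S : Setup k K)

/-- `X` as a `k`-scheme. [folklore] -/
abbrev XO : Over (Spec (CommRingCat.of k)) := Over.mk S.f

/-- `ℙⁿ_k` as a `k`-scheme. [folklore] -/
abbrev PO : Over (Spec (CommRingCat.of k)) := projectiveSpace S.n k

/-- `X_K`, the cone point of the level-one diagram of `X`. [folklore] -/
abbrev XK : Scheme.{u} := pullback (Spec.map (σ₁ k K)) S.f

/-- The cone point of the level-one diagram for `X` is `X_K` (by `rfl`). [folklore] -/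
theorem c₁_XO_pt : (c₁ k K ∅ S.XO).pt = S.XK := rfl

/-- `P_K = Spec K ×_k ℙⁿ_k`, the cone point of the level-one diagram of `ℙⁿ_k`. [folklore] -/
abbrev PK : Scheme.{u} := pullback (Spec.map (σ₁ k K)) (projectiveSpace S.n k).hom

/-- The closed `K`-immersion `X̄̄₁ ↪ ℙⁿ_K` as a morphism of schemes. [folklore] -/
def cbarL : S.Xbar₁ ⟶ (projectiveSpace S.n K).left := S.cbar.left

/-- `cbarL` is a closed immersion. [folklore] -/
instance isClosedImmersion_cbarL : IsClosedImmersion S.cbarL := S.isClosedImmersion_cbar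

/-- `cbarL` lies over `Spec K`. [folklore] -/
theorem cbarL_w : S.cbarL ≫ (projectiveSpace S.n K).hom = S.g := Over.w S.cbar

/-- The base-change isomorphism `ℙⁿ_K ≅ ℙⁿ_k ×_k Spec K` on schemes. [folklore] -/
def bcP : (projectiveSpace S.n K).left ⟶
    pullback (projectiveSpace S.n k).hom (Spec.map (σ₁ k K)) :=
  (projectiveSpaceBaseChangeIso k K S.n).hom.left

/-- `bcP` is an isomorphism. [folklore] -/
instance isIso_bcP : IsIso S.bcP :=
  inferInstanceAs (IsIso ((Over.forget _).map (projectiveSpaceBaseChangeIso k K S.n).hom))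

/-- `bcP` lies over `Spec K`. [folklore] -/
theorem bcP_snd : S.bcP ≫ pullback.snd (projectiveSpace S.n k).hom (Spec.map (σ₁ k K)) =
    (projectiveSpace S.n K).hom :=
  Over.w (projectiveSpaceBaseChangeIso k K S.n).hom

/-- The closed immersion `X̄̄₁ ↪ ℙⁿ_K ≅ ℙⁿ_k ×_k Spec K ≅ Spec K ×_k ℙⁿ_k = P_K`. [folklore] -/
def cbar' : S.Xbar₁ ⟶ S.PK :=
  S.cbarL ≫ S.bcP ≫ (pullbackSymmetry (projectiveSpace S.n k).hom (Spec.map (σ₁ k K))).hom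

/-- `cbar'` is a closed immersion. [folklore] -/
instance isClosedImmersion_cbar' : IsClosedImmersion S.cbar' := by
  unfold cbar'
  infer_instance

/-- `cbar'` lies over `Spec K`: `cbar' ≫ pr_{Spec K} = g`. [folklore] -/
theorem cbar'_fst :
    S.cbar' ≫ pullback.fst (Spec.map (σ₁ k K)) (projectiveSpace S.n k).hom = S.g := by
  have h : (pullbackSymmetry (projectiveSpace S.n k).hom (Spec.map (σ₁ k K))).hom ≫
      pullback.fst (Spec.map (σ₁ k K)) (projectiveSpace S.n k).hom =
      pullback.snd (projectiveSpace S.n k).hom (Spec.map (σ₁ k K)) :=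
    pullbackSymmetry_hom_comp_fst _ _
  calc S.cbar' ≫ pullback.fst (Spec.map (σ₁ k K)) (projectiveSpace S.n k).hom
      = S.cbarL ≫ S.bcP ≫ ((pullbackSymmetry (projectiveSpace S.n k).hom
          (Spec.map (σ₁ k K))).hom ≫
          pullback.fst (Spec.map (σ₁ k K)) (projectiveSpace S.n k).hom) := by
        simp only [cbar', Category.assoc]
    _ = S.cbarL ≫ (S.bcP ≫ pullback.snd (projectiveSpace S.n k).hom (Spec.map (σ₁ k K))) := by
        rw [h]
    _ = S.cbarL ≫ (projectiveSpace S.n K).hom := congrArg (S.cbarL ≫ ·) S.bcP_snd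
    _ = S.g := S.cbarL_w

/-! ## Instances for the limit arguments on the level-one cones -/

/-- `ℙⁿ_k → Spec k` is proper. [folklore] -/
instance isProper_PO_hom : IsProper S.PO.hom := isProper_projectiveSpace S.n k

/-- `X → Spec k` is quasi-compact (instance on the `Over` object). [folklore] -/
instance quasiCompact_XO_hom : QuasiCompact S.XO.hom := S.quasiCompact_f

/-- `X → Spec k` is quasi-separated (instance on the `Over` object). [folklore] -/
instance quasiSeparated_XO_hom : QuasiSeparated S.XO.hom := inferInstanceAs (QuasiSeparated S.f)

/-- `X → Spec k` is locally of finite type (instance on the `Over` object). [folklore] -/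
instance locallyOfFiniteType_XO_hom : LocallyOfFiniteType S.XO.hom := S.locallyOfFiniteType_f

/-- `X_K` is locally Noetherian (of finite type over `K`). [folklore] -/
instance isLocallyNoetherian_XK_pt : IsLocallyNoetherian (c₁ k K ∅ S.XO).pt :=
  LocallyOfFiniteType.isLocallyNoetherian (pullback.fst (Spec.map (σ₁ k K)) S.f)

/-- `P_K` is locally Noetherian. [folklore] -/
instance isLocallyNoetherian_PK_pt : IsLocallyNoetherian (c₁ k K ∅ S.PO).pt :=
  LocallyOfFiniteType.isLocallyNoetherian
    (pullback.fst (Spec.map (σ₁ k K)) (projectiveSpace S.n k).hom)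

/-! ## The first stage `s₀`: `X̄'` and `X̄̄₁` come from `X_{s₀}` and `P_{s₀}` -/

/-- The leg `P_K → P_j` of the level-one cone of `ℙⁿ_k`. [folklore] -/
abbrev legP (j : (Idx K (∅ : Finset K))ᵒᵖ) : S.PK ⟶ (D₁ k K ∅ S.PO).obj j :=
  ((c₁ k K ∅ S.PO).π.app j : (c₁ k K ∅ S.PO).pt ⟶ (D₁ k K ∅ S.PO).obj j)

/-- The leg `X_K → X_j` of the level-one cone of `X`. [folklore] -/
abbrev legX (j : (Idx K (∅ : Finset K))ᵒᵖ) : S.XK ⟶ (D₁ k K ∅ S.XO).obj j :=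
  ((c₁ k K ∅ S.XO).π.app j : (c₁ k K ∅ S.XO).pt ⟶ (D₁ k K ∅ S.XO).obj j)

/-- `ιb` as a morphism to the cone point. [folklore] -/
abbrev ιb' : S.Xb ⟶ (c₁ k K ∅ S.XO).pt := S.ιb

/-- `cbar'` as a morphism to the cone point. [folklore] -/
abbrev cbar'' : S.Xbar₁ ⟶ (c₁ k K ∅ S.PO).pt := S.cbar'

/-- A stage from which on `X̄̄₁ ↪ P_K` is the base change of its scheme-theoretic images
(Görtz–Wedhorn I, Prop. 10.75 (1), `exists_isPullback_toImage_of_isLocallyNoetherian`).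
[cite: GortzWedhorn2020, Prop. 10.75 (1), p. 333] -/
def sA : (Idx K (∅ : Finset K))ᵒᵖ :=
  (exists_isPullback_toImage_of_isLocallyNoetherian (D₁ k K ∅ S.PO) (c₁ k K ∅ S.PO)
    (isLimit_c₁ k K ∅ S.PO) S.cbar'').choose

/-- The defining property of `sA`. [cite: GortzWedhorn2020, Prop. 10.75 (1), p. 333] -/
theorem sA_spec (j : (Idx K (∅ : Finset K))ᵒᵖ) (φ : j ⟶ S.sA) :
    IsPullback S.cbar'' (S.cbar'' ≫ S.legP j).toImage (S.legP j) (S.cbar'' ≫ S.legP j).imageι :=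
  (exists_isPullback_toImage_of_isLocallyNoetherian (D₁ k K ∅ S.PO) (c₁ k K ∅ S.PO)
    (isLimit_c₁ k K ∅ S.PO) S.cbar'').choose_spec j φ

/-- A stage from which on `X̄' ↪ X_K` is the base change of its scheme-theoretic images.
[cite: GortzWedhorn2020, Prop. 10.75 (1), p. 333] -/
def sB : (Idx K (∅ : Finset K))ᵒᵖ :=
  (exists_isPullback_toImage_of_isLocallyNoetherian (D₁ k K ∅ S.XO) (c₁ k K ∅ S.XO)
    (isLimit_c₁ k K ∅ S.XO) S.ιb').choose

/-- The defining property of `sB`. [cite: GortzWedhorn2020, Prop. 10.75 (1), p. 333] -/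
theorem sB_spec (j : (Idx K (∅ : Finset K))ᵒᵖ) (φ : j ⟶ S.sB) :
    IsPullback S.ιb' (S.ιb' ≫ S.legX j).toImage (S.legX j) (S.ιb' ≫ S.legX j).imageι :=
  (exists_isPullback_toImage_of_isLocallyNoetherian (D₁ k K ∅ S.XO) (c₁ k K ∅ S.XO)
    (isLimit_c₁ k K ∅ S.XO) S.ιb').choose_spec j φ

/-- **The first stage `s₀`** (a common refinement of `sA` and `sB`). [folklore] -/
def s₀ : (Idx K (∅ : Finset K))ᵒᵖ := IsCofiltered.min S.sA S.sB

/-- The finite set `t₀ ⊆ K` of the first stage; `k₀ = k(t₀)`. [folklore] -/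
abbrev t₀ : Finset K := S.s₀.unop.1

/-- The field `k₀ = k(t₀)` of the first stage, as an object of `CommRingCat` (it is the value
of the ring diagram at `s₀`, by `rfl`). [folklore] -/
abbrev k₀ : CommRingCat.{u} := (ringDiagram k K ∅).obj S.s₀.unop

/-- `P₀ = P_{s₀} = Spec k₀ ×_k ℙⁿ_k`. [folklore] -/
abbrev P₀ : Scheme.{u} := (D₁ k K ∅ S.PO).obj S.s₀

/-- `X₀ = X_{s₀} = Spec k₀ ×_k X`. [folklore] -/
abbrev X₀ : Scheme.{u} := (D₁ k K ∅ S.XO).obj S.s₀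

/-- `X̄̄₀ ↪ P₀`, the scheme-theoretic image of `X̄̄₁ → P_K → P₀`. [folklore] -/
abbrev Xbar₀ : Scheme.{u} := (S.cbar'' ≫ S.legP S.s₀).image

/-- The closed immersion `X̄̄₀ ↪ P₀`. [folklore] -/
abbrev Xbar₀ι : S.Xbar₀ ⟶ S.P₀ := (S.cbar'' ≫ S.legP S.s₀).imageι

/-- `X̄̄₁ → X̄̄₀`. [folklore] -/
abbrev toXbar₀ : S.Xbar₁ ⟶ S.Xbar₀ := (S.cbar'' ≫ S.legP S.s₀).toImage

/-- `X'₀ ↪ X₀`, the scheme-theoretic image of `X̄' → X_K → X₀`. [folklore] -/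
abbrev X'₀ : Scheme.{u} := (S.ιb' ≫ S.legX S.s₀).image

/-- The closed immersion `X'₀ ↪ X₀`. [folklore] -/
abbrev X'₀ι : S.X'₀ ⟶ S.X₀ := (S.ιb' ≫ S.legX S.s₀).imageι

/-- `X̄' → X'₀`. [folklore] -/
abbrev toX'₀ : S.Xb ⟶ S.X'₀ := (S.ιb' ≫ S.legX S.s₀).toImage

/-- `X̄̄₁ = X̄̄₀ ×_{P₀} P_K`. [cite: GortzWedhorn2020, Prop. 10.75 (1), p. 333] -/
theorem sqA : IsPullback S.cbar'' S.toXbar₀ (S.legP S.s₀) S.Xbar₀ι :=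
  S.sA_spec S.s₀ (IsCofiltered.minToLeft _ _)

/-- `X̄' = X'₀ ×_{X₀} X_K`. [cite: GortzWedhorn2020, Prop. 10.75 (1), p. 333] -/
theorem sqB : IsPullback S.ιb' S.toX'₀ (S.legX S.s₀) S.X'₀ι :=
  S.sB_spec S.s₀ (IsCofiltered.minToRight _ _)

/-- The structure morphism `q₀ : X̄̄₀ → Spec k₀`. [folklore] -/
abbrev q₀ : S.Xbar₀ ⟶ Spec S.k₀ :=
  S.Xbar₀ι ≫ pullback.fst (Spec.map ((baseNat k K ∅).app S.s₀.unop)) (projectiveSpace S.n k).hom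

/-- The structure morphism `X'₀ → Spec k₀`. [folklore] -/
abbrev qX₀ : S.X'₀ ⟶ Spec S.k₀ :=
  S.X'₀ι ≫ pullback.fst (Spec.map ((baseNat k K ∅).app S.s₀.unop)) S.f

/-- The structure morphism `X̄' → Spec K`. [folklore] -/
abbrev gb : S.Xb ⟶ Spec (CommRingCat.of K) := S.ιb ≫ pullback.fst (Spec.map (σ₁ k K)) S.f

/-- `Spec K → Spec k₀`. [folklore] -/
abbrev sK₀ : Spec (CommRingCat.of K) ⟶ Spec S.k₀ := Spec.map ((ringCocone k K ∅).ι.app S.s₀.unop)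

/-- **`X̄̄₁ → X̄̄₀` is the base change of `Spec K → Spec k₀`** (paste `sqA` with the leg square
of the level-one cone). [folklore] -/
theorem isPullback_toXbar₀ : IsPullback S.toXbar₀ S.g S.q₀ S.sK₀ := by
  have h := S.sqA.flip.paste_vert
    (isPullback_π k K ∅ (.of k) (baseNat k K ∅) (σ₁ k K) (baseNat_ι k K ∅) S.PO S.s₀)
  rwa [S.cbar'_fst] at h

/-- **`X̄' → X'₀` is the base change of `Spec K → Spec k₀`.** [folklore] -/
theorem isPullback_toX'₀ : IsPullback S.toX'₀ S.gb S.qX₀ S.sK₀ :=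
  S.sqB.flip.paste_vert
    (isPullback_π k K ∅ (.of k) (baseNat k K ∅) (σ₁ k K) (baseNat_ι k K ∅) S.XO S.s₀)

/-- `X̄̄₀` is integral. [folklore] -/
instance isIntegral_Xbar₀ : IsIntegral S.Xbar₀ := ChowLemmaProof.isIntegral_image _

/-- `X'₀` is integral. [folklore] -/
instance isIntegral_X'₀ : IsIntegral S.X'₀ := ChowLemmaProof.isIntegral_image _

/-! ## Generalities -/

/-- Over a locally Noetherian base, locally of finite type implies locally of finite
presentation. [folklore] -/
theorem locallyOfFinitePresentation_of_isLocallyNoetherian {Y T : Scheme.{u}} (q : Y ⟶ T)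
    [LocallyOfFiniteType q] [IsLocallyNoetherian T] : LocallyOfFinitePresentation q := by
  rw [HasRingHomProperty.iff_appLE (P := @LocallyOfFinitePresentation)]
  intro U V e
  haveI := IsLocallyNoetherian.component_noetherian (X := T) U
  exact RingHom.FinitePresentation.of_finiteType.mp
    (HasRingHomProperty.appLE @LocallyOfFiniteType q inferInstance U V e)

/-! ## The level-two diagram: base changes of `X̄̄₀` over `k₀` -/

/-- The inclusion `k₀ ⊆ K` in `CommRingCat`. [folklore] -/
abbrev σ₂ : S.k₀ ⟶ CommRingCat.of K := CommRingCat.ofHom (fld k K S.t₀).val.toRingHom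

/-- `X̄̄₀` as a `k₀`-scheme. [folklore] -/
abbrev EO : Over (Spec S.k₀) := Over.mk S.q₀

/-- `X'₀` as a `k₀`-scheme. [folklore] -/
abbrev X'O : Over (Spec S.k₀) := Over.mk S.qX₀

/-- `q₀` is quasi-compact (instance on the `Over` object). [folklore] -/
instance quasiCompact_EO_hom : QuasiCompact S.EO.hom := inferInstanceAs (QuasiCompact S.q₀)

/-- `q₀` is quasi-separated (instance on the `Over` object). [folklore] -/
instance quasiSeparated_EO_hom : QuasiSeparated S.EO.hom := inferInstanceAs (QuasiSeparated S.q₀)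

/-- `q₀` is locally of finite type (instance on the `Over` object). [folklore] -/
instance locallyOfFiniteType_EO_hom : LocallyOfFiniteType S.EO.hom :=
  inferInstanceAs (LocallyOfFiniteType S.q₀)

/-- `qX₀` is quasi-compact (instance on the `Over` object). [folklore] -/
instance quasiCompact_X'O_hom : QuasiCompact S.X'O.hom := inferInstanceAs (QuasiCompact S.qX₀)

/-- `qX₀` is quasi-separated (instance on the `Over` object). [folklore] -/
instance quasiSeparated_X'O_hom : QuasiSeparated S.X'O.hom := inferInstanceAs (QuasiSeparated S.qX₀)

/-- `qX₀` is locally of finite type (instance on the `Over` object). [folklore] -/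
instance locallyOfFiniteType_X'O_hom : LocallyOfFiniteType S.X'O.hom :=
  inferInstanceAs (LocallyOfFiniteType S.qX₀)

/-- `k₀` is a Noetherian ring (a finitely generated `k`-algebra). [folklore] -/
instance isNoetherianRing_k₀ : IsNoetherianRing S.k₀ := by
  haveI : Algebra.FiniteType k (fld k K S.t₀) :=
    (Subalgebra.fg_iff_finiteType _).mp (Subalgebra.fg_adjoin_finset _)
  exact Algebra.FiniteType.isNoetherianRing k (fld k K S.t₀)

/-- `Spec k₀` is locally Noetherian. [folklore] -/
instance isLocallyNoetherian_Spec_k₀ : IsLocallyNoetherian (Spec S.k₀) := inferInstance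

/-- `qX₀` is locally of finite presentation. [folklore] -/
instance locallyOfFinitePresentation_qX₀ : LocallyOfFinitePresentation S.qX₀ :=
  locallyOfFinitePresentation_of_isLocallyNoetherian _

/-- The level-two diagram `t ↦ E_t = Spec k(t) ×_{k₀} X̄̄₀`, `t ⊇ t₀`. [folklore] -/
abbrev E : (Idx K S.t₀)ᵒᵖ ⥤ Scheme.{u} := schemeDiagram k K S.t₀ S.k₀ (stageNat k K S.t₀) S.EO

/-- Its cone with point `E_K = Spec K ×_{k₀} X̄̄₀`. [folklore] -/
abbrev cE : Cone S.E := schemeCone k K S.t₀ S.k₀ (stageNat k K S.t₀) S.σ₂ (stageNat_ι k K S.t₀) S.EO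

/-- `E_K = lim E_t`. [folklore] -/
abbrev isLimit_cE : IsLimit S.cE :=
  isLimitSchemeCone k K S.t₀ S.k₀ (stageNat k K S.t₀) S.σ₂ (stageNat_ι k K S.t₀) S.EO

/-- The level-two diagram of `X'₀`: `t ↦ X'_t = Spec k(t) ×_{k₀} X'₀`. [folklore] -/
abbrev DX : (Idx K S.t₀)ᵒᵖ ⥤ Scheme.{u} := schemeDiagram k K S.t₀ S.k₀ (stageNat k K S.t₀) S.X'O

/-- Its cone with point `Spec K ×_{k₀} X'₀`. [folklore] -/
abbrev cX : Cone S.DX := schemeCone k K S.t₀ S.k₀ (stageNat k K S.t₀) S.σ₂ (stageNat_ι k K S.t₀) S.X'O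

/-- `E_K` is locally Noetherian. [folklore] -/
instance isLocallyNoetherian_cE_pt : IsLocallyNoetherian S.cE.pt :=
  LocallyOfFiniteType.isLocallyNoetherian (pullback.fst (Spec.map S.σ₂) S.q₀)

/-- **`X̄̄₁ ≅ E_K`**: both are the base change of `X̄̄₀` along `Spec K → Spec k₀`. [folklore] -/
def e₁ : S.Xbar₁ ≅ S.cE.pt := S.isPullback_toXbar₀.flip.isoPullback

/-- `e₁` commutes with the maps to `Spec K`. [folklore] -/
@[reassoc]
theorem e₁_hom_fst : S.e₁.hom ≫ pullback.fst (Spec.map S.σ₂) S.q₀ = S.g :=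
  S.isPullback_toXbar₀.flip.isoPullback_hom_fst

/-- `e₁` commutes with the maps to `X̄̄₀`. [folklore] -/
@[reassoc]
theorem e₁_hom_snd : S.e₁.hom ≫ pullback.snd (Spec.map S.σ₂) S.q₀ = S.toXbar₀ :=
  S.isPullback_toXbar₀.flip.isoPullback_hom_snd

/-- **`X̄' ≅ Spec K ×_{k₀} X'₀`.** [folklore] -/
def eb : S.Xb ≅ S.cX.pt := S.isPullback_toX'₀.flip.isoPullback

/-- `eb` commutes with the maps to `Spec K`. [folklore] -/
@[reassoc]
theorem eb_hom_fst : S.eb.hom ≫ pullback.fst (Spec.map S.σ₂) S.qX₀ = S.gb :=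
  S.isPullback_toX'₀.flip.isoPullback_hom_fst

/-- `eb` commutes with the maps to `X'₀`. [folklore] -/
@[reassoc]
theorem eb_hom_snd : S.eb.hom ≫ pullback.snd (Spec.map S.σ₂) S.qX₀ = S.toX'₀ :=
  S.isPullback_toX'₀.flip.isoPullback_hom_snd

/-- The leg `X̄̄₁ ≅ E_K → E_t`. [folklore] -/
def legE (t : (Idx K S.t₀)ᵒᵖ) : S.Xbar₁ ⟶ S.E.obj t :=
  S.e₁.hom ≫ (S.cE.π.app t : S.cE.pt ⟶ S.E.obj t)

/-- The leg `X̄' ≅ Spec K ×_{k₀} X'₀ → X'_t`. [folklore] -/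
def legXb (t : (Idx K S.t₀)ᵒᵖ) : S.Xb ⟶ S.DX.obj t :=
  S.eb.hom ≫ (S.cX.π.app t : S.cX.pt ⟶ S.DX.obj t)

/-- The structure morphism `E_t → Spec k(t)`. [folklore] -/
abbrev qE (t : (Idx K S.t₀)ᵒᵖ) : S.E.obj t ⟶ Spec ((ringDiagram k K S.t₀).obj t.unop) :=
  pullback.fst (Spec.map ((stageNat k K S.t₀).app t.unop)) S.q₀

/-- The structure morphism `X'_t → Spec k(t)`. [folklore] -/
abbrev qX (t : (Idx K S.t₀)ᵒᵖ) : S.DX.obj t ⟶ Spec ((ringDiagram k K S.t₀).obj t.unop) :=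
  pullback.fst (Spec.map ((stageNat k K S.t₀).app t.unop)) S.qX₀

/-- `Spec K → Spec k(t)`. [folklore] -/
abbrev sK (t : (Idx K S.t₀)ᵒᵖ) : Spec (CommRingCat.of K) ⟶ Spec ((ringDiagram k K S.t₀).obj t.unop) :=
  Spec.map ((ringCocone k K S.t₀).ι.app t.unop)

/-- **`X̄̄₁ → E_t` is the base change of `Spec K → Spec k(t)`.** [folklore] -/
theorem isPullback_legE (t : (Idx K S.t₀)ᵒᵖ) : IsPullback (S.legE t) S.g (S.qE t) (S.sK t) := by
  have h1 : IsPullback S.e₁.hom S.g (pullback.fst (Spec.map S.σ₂) S.q₀) (𝟙 _) :=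
    IsPullback.of_horiz_isIso ⟨by rw [S.e₁_hom_fst, Category.comp_id]⟩
  have h2 := h1.paste_horiz
    (isPullback_π k K S.t₀ S.k₀ (stageNat k K S.t₀) S.σ₂ (stageNat_ι k K S.t₀) S.EO t)
  rw [Category.id_comp] at h2
  exact h2

/-- **`X̄' → X'_t` is the base change of `Spec K → Spec k(t)`.** [folklore] -/
theorem isPullback_legXb (t : (Idx K S.t₀)ᵒᵖ) : IsPullback (S.legXb t) S.gb (S.qX t) (S.sK t) := by
  have h1 : IsPullback S.eb.hom S.gb (pullback.fst (Spec.map S.σ₂) S.qX₀) (𝟙 _) :=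
    IsPullback.of_horiz_isIso ⟨by rw [S.eb_hom_fst, Category.comp_id]⟩
  have h2 := h1.paste_horiz
    (isPullback_π k K S.t₀ S.k₀ (stageNat k K S.t₀) S.σ₂ (stageNat_ι k K S.t₀) S.X'O t)
  rw [Category.id_comp] at h2
  exact h2

/-! ## Step C: the open `X₁ ⊆ X̄̄₁` comes from a finite stage -/

/-- `X_K` is quasi-compact. [folklore] -/
instance compactSpace_XK : CompactSpace S.XK := by
  haveI : CompactSpace S.X := (HasAffineProperty.iff_of_isAffine (P := @QuasiCompact)).mp
    S.quasiCompact_f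
  exact QuasiCompact.compactSpace_of_compactSpace (pullback.snd (Spec.map (σ₁ k K)) S.f)

/-- `X̄'` is quasi-compact. [folklore] -/
instance compactSpace_Xb : CompactSpace S.Xb :=
  QuasiCompact.compactSpace_of_compactSpace S.ιb

/-- `X₁` is quasi-compact. [folklore] -/
instance compactSpace_X₁ : CompactSpace S.X₁ := by
  haveI := S.isAlteration_φ₁.isProper
  exact QuasiCompact.compactSpace_of_compactSpace S.φ₁

/-- The open `V̄ ⊆ E_K` corresponding to `j₁(X₁) ⊆ X̄̄₁`. [folklore] -/
abbrev Vbar : S.cE.pt.Opens := S.e₁.inv ⁻¹ᵁ S.j₁.opensRange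

/-- `V̄` is quasi-compact. [folklore] -/
theorem isCompact_Vbar : IsCompact (S.Vbar : Set S.cE.pt) := by
  have h1 : IsCompact (S.j₁.opensRange : Set S.Xbar₁) := by
    change IsCompact (Set.range S.j₁)
    rw [← Set.image_univ]
    exact isCompact_univ.image S.j₁.continuous
  have hl : ∀ y, S.e₁.inv (S.e₁.hom y) = y := fun y => by
    rw [← Scheme.Hom.comp_apply, Iso.hom_inv_id]; rfl
  have hr : ∀ x, S.e₁.hom (S.e₁.inv x) = x := fun x => by
    rw [← Scheme.Hom.comp_apply, Iso.inv_hom_id]; rfl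
  have h2 : (S.Vbar : Set S.cE.pt) = S.e₁.hom '' (S.j₁.opensRange : Set S.Xbar₁) := by
    ext x
    constructor
    · intro hx
      exact ⟨S.e₁.inv x, hx, hr x⟩
    · rintro ⟨y, hy, rfl⟩
      change S.e₁.inv (S.e₁.hom y) ∈ S.j₁.opensRange
      rwa [hl]
  rw [h2]
  exact h1.image S.e₁.hom.continuous

/-- A stage `iC` and an open `V_C ⊆ E_{iC}` pulling back to `V̄` (Görtz–Wedhorn I, Thm. 10.57
(2); Stacks 01Z4; Mathlib `exists_preimage_eq`). [cite: GortzWedhorn2020, Thm. 10.57 (2), p. 325] -/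
def iC : (Idx K S.t₀)ᵒᵖ := (exists_preimage_eq S.E S.cE S.isLimit_cE S.Vbar S.isCompact_Vbar).choose

/-- The open `V_C ⊆ E_{iC}`. [cite: GortzWedhorn2020, Thm. 10.57 (2), p. 325] -/
def VC : (S.E.obj S.iC).Opens :=
  (exists_preimage_eq S.E S.cE S.isLimit_cE S.Vbar S.isCompact_Vbar).choose_spec.choose

/-- `V_C` is quasi-compact. [folklore] -/
theorem isCompact_VC : IsCompact (S.VC : Set (S.E.obj S.iC)) :=
  (exists_preimage_eq S.E S.cE S.isLimit_cE S.Vbar S.isCompact_Vbar).choose_spec.choose_spec.1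

/-- The preimage of `V_C` in `E_K` (as an open of the cone point). [folklore] -/
abbrev Vpre : S.cE.pt.Opens := (S.cE.π.app S.iC : S.cE.pt ⟶ S.E.obj S.iC) ⁻¹ᵁ S.VC

/-- `V_C` pulls back to `V̄`. [cite: GortzWedhorn2020, Thm. 10.57 (2), p. 325] -/
theorem preimage_VC : S.Vpre = S.Vbar :=
  (exists_preimage_eq S.E S.cE S.isLimit_cE S.Vbar S.isCompact_Vbar).choose_spec.choose_spec.2

/-! ## Step D: the morphism `φ̄₁` comes from a finite stage -/

/-- The diagram of preimages of `V_C` in the `E_t`, `t ⊇ iC`. [folklore] -/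
abbrev OD : Over S.iC ⥤ Scheme.{u} := opensDiagram S.E S.iC S.VC

/-- Its cone with point `V̄`. [folklore] -/
abbrev ocone : Cone S.OD := opensCone S.E S.cE S.iC S.VC

/-- `V̄ = lim_t (E_t → E_{iC})⁻¹ V_C`. [folklore] -/
abbrev isLimit_ocone : IsLimit S.ocone := isLimitOpensCone S.E S.cE S.isLimit_cE S.iC S.VC

/-- The objects of the diagram of preimages are quasi-compact. [folklore] -/
instance compactSpace_OD_obj (j : Over S.iC) : CompactSpace (S.OD.obj j) :=
  isCompact_iff_compactSpace.mp
    (QuasiCompact.isCompact_preimage (f := S.E.map j.hom) _ S.VC.2 S.isCompact_VC)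

/-- The objects of the diagram of preimages are quasi-separated. [folklore] -/
instance quasiSeparatedSpace_OD_obj (j : Over S.iC) : QuasiSeparatedSpace (S.OD.obj j) :=
  (isQuasiSeparated_iff_quasiSeparatedSpace _ (S.E.map j.hom ⁻¹ᵁ S.VC).2).mp
    (.of_quasiSeparatedSpace _)

/-- The structure maps of the diagram of preimages to `Spec k₀`. [folklore] -/
abbrev t₂ : S.OD ⟶ (Functor.const (Over S.iC)).obj (Spec S.k₀) :=
  opensDiagramι S.E S.iC S.VC ≫
    (Over.forget S.iC).whiskerLeft (toBase k K S.t₀ S.k₀ (stageNat k K S.t₀) S.EO)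

/-- The isomorphism `V̄ ≅ X₁` (`V̄ = e₁⁻¹(j₁(X₁))`). [folklore] -/
def VbarIso : (S.Vbar : Scheme.{u}) ≅ S.X₁ :=
  asIso (S.e₁.inv ∣_ S.j₁.opensRange) ≪≫ S.j₁.isoOpensRange.symm

/-- `VbarIso` followed by `j₁` is the inclusion of `V̄` followed by `e₁⁻¹`. [folklore] -/
@[reassoc]
theorem VbarIso_hom_j₁ : S.VbarIso.hom ≫ S.j₁ = S.Vbar.ι ≫ S.e₁.inv := by
  simp only [VbarIso, Iso.trans_hom, asIso_hom, Iso.symm_hom, Category.assoc,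
    Scheme.Hom.isoOpensRange_inv_comp, morphismRestrict_ι]

/-- The `k₀`-morphism `V̄ ≅ X₁ → X̄' → X'₀` from the cone point of the diagram of preimages.
[folklore] -/
def aD : S.ocone.pt ⟶ S.X'₀ :=
  (S.cE.pt.isoOfEq S.preimage_VC).hom ≫ S.VbarIso.hom ≫ S.φ₁ ≫ S.toX'₀

/-- The structure maps of the diagram of preimages, evaluated (by `rfl`). [folklore] -/
theorem t₂_app (j : Over S.iC) :
    S.t₂.app j = (S.E.map j.hom ⁻¹ᵁ S.VC).ι ≫
      pullback.snd (Spec.map ((stageNat k K S.t₀).app j.left.unop)) S.q₀ ≫ S.q₀ := rfl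

/-- `Spec K → Spec k₀` of the level-one cocone is `Spec σ₂` (by `rfl`). [folklore] -/
theorem sK₀_eq : S.sK₀ = Spec.map S.σ₂ := rfl

/-- `e₁⁻¹` followed by `g` is the projection `E_K → Spec K`. [folklore] -/
@[reassoc]
theorem e₁_inv_g : S.e₁.inv ≫ S.g = pullback.fst (Spec.map S.σ₂) S.q₀ := by
  rw [Iso.inv_comp_eq, S.e₁_hom_fst]

/-- **The compatibility of `aD` with the cone**: both `V̄ → E_t → Spec k₀` and
`V̄ ≅ X₁ → X̄' → X'₀ → Spec k₀` are the structure map of `V̄` over `k₀`. [folklore] -/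
theorem ocone_π_t₂ : S.ocone.π ≫ S.t₂ = (Functor.const (Over S.iC)).map (S.aD ≫ S.qX₀) := by
  ext j
  rw [NatTrans.comp_app, S.t₂_app, Functor.const_map_app]
  -- the left hand side is `V̄ → E_K → Spec K → Spec k₀`
  have hι : S.ocone.π.app j ≫ (S.E.map j.hom ⁻¹ᵁ S.VC).ι =
      S.Vpre.ι ≫ (S.cE.π.app j.left : S.cE.pt ⟶ S.E.obj j.left) :=
    Scheme.Hom.resLE_comp_ι _ _
  have hsnd : (S.cE.π.app j.left : S.cE.pt ⟶ S.E.obj j.left) ≫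
      pullback.snd (Spec.map ((stageNat k K S.t₀).app j.left.unop)) S.q₀ =
      pullback.snd (Spec.map S.σ₂) S.q₀ :=
    schemeCone_π_app_snd k K S.t₀ S.k₀ (stageNat k K S.t₀) S.σ₂ (stageNat_ι k K S.t₀) S.EO j.left
  have hL : (S.cE.π.app j.left : S.cE.pt ⟶ S.E.obj j.left) ≫
      pullback.snd (Spec.map ((stageNat k K S.t₀).app j.left.unop)) S.q₀ ≫ S.q₀ =
      pullback.fst (Spec.map S.σ₂) S.q₀ ≫ Spec.map S.σ₂ := by
    rw [← Category.assoc, hsnd]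
    exact (pullback.condition (f := Spec.map S.σ₂) (g := S.q₀)).symm
  -- the right hand side is `V̄ ≅ X₁ → X̄' → X'₀ → Spec k₀`
  have h1 : S.toX'₀ ≫ S.qX₀ = S.gb ≫ S.sK₀ := S.isPullback_toX'₀.w
  have h2 : S.φ₁ ≫ S.gb ≫ S.sK₀ = S.j₁ ≫ S.g ≫ S.sK₀ := by
    rw [← Category.assoc, ← Category.assoc S.j₁]
    congr 1
    rw [S.w]
  have h3 : S.VbarIso.hom ≫ S.j₁ ≫ S.g ≫ S.sK₀ = S.Vbar.ι ≫ S.e₁.inv ≫ S.g ≫ S.sK₀ := by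
    rw [← Category.assoc, S.VbarIso_hom_j₁, Category.assoc]
  have hR : S.aD ≫ S.qX₀ = S.Vpre.ι ≫ pullback.fst (Spec.map S.σ₂) S.q₀ ≫ Spec.map S.σ₂ := by
    simp only [aD, Category.assoc]
    rw [h1, h2, h3, S.e₁_inv_g_assoc, Scheme.isoOfEq_hom_ι_assoc, sK₀_eq]
  refine Eq.trans ?_ hR.symm
  refine Eq.trans (Category.assoc _ _ _).symm ?_
  refine Eq.trans (congrArg (· ≫ pullback.snd (Spec.map ((stageNat k K S.t₀).app j.left.unop))
    S.q₀ ≫ S.q₀) hι) ?_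
  refine Eq.trans (Category.assoc _ _ _) ?_
  exact congrArg (S.Vpre.ι ≫ ·) hL

/-- **Step D** (Görtz–Wedhorn I, Thm. 10.63; Stacks 01ZC; Mathlib
`Scheme.exists_π_app_comp_eq_of_locallyOfFinitePresentation`): the `k₀`-morphism
`V̄ ≅ X₁ → X'₀` factors through the preimage of `V_C` at some stage `jD`.
[cite: GortzWedhorn2020, Thm. 10.63, p. 328] -/
theorem exists_stageD : ∃ (j : Over S.iC) (g : S.OD.obj j ⟶ S.X'₀),
    S.ocone.π.app j ≫ g = S.aD ∧ g ≫ S.qX₀ = S.t₂.app j :=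
  Scheme.exists_π_app_comp_eq_of_locallyOfFinitePresentation S.OD S.t₂ S.qX₀ S.ocone
    S.isLimit_ocone S.aD S.ocone_π_t₂

/-- The stage `jD` of Step D. [cite: GortzWedhorn2020, Thm. 10.63, p. 328] -/
def jD : Over S.iC := S.exists_stageD.choose

/-- The descended morphism `gD : (E_{jD} → E_{iC})⁻¹ V_C → X'₀`. [cite: GortzWedhorn2020, Thm. 10.63, p. 328] -/
def gD : S.OD.obj S.jD ⟶ S.X'₀ := S.exists_stageD.choose_spec.choose

/-- `gD` restricts to `aD` on `V̄`. [folklore] -/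
theorem ocone_π_gD : S.ocone.π.app S.jD ≫ S.gD = S.aD := S.exists_stageD.choose_spec.choose_spec.1

/-- `gD` is a `k₀`-morphism. [folklore] -/
theorem gD_qX₀ : S.gD ≫ S.qX₀ = S.t₂.app S.jD := S.exists_stageD.choose_spec.choose_spec.2

end Setup




end DeJong1996.Descent45

end Literature.AlgebraicGeometry.Resolution

end
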